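import Summits.HodgeConjecture.HodgeConjecture.Theorems.NikulinTwinTransportLefschetzOneOneK3Holomorphy
import Literature.Geometry.Kaehler.LocalPQForms

/-!
# Route NikulinTwinTransport — `LefschetzOneOneK3`, `∂∂̄`–exponential line: pointwise calculus of the zigzag

Pointwise lemmas for the Čech–`∂̄` construction of a holomorphic line bundle from a closed real
`(1,1)`-form (helper file for the route item `LefschetzOneOneK3`; continuation of
`NikulinTwinTransportLefschetzOneOneK3Holomorphy.lean`):

* locality / smoothness of type components at a point (`smoothAt_typeComponent`), conjugates of
  forms smooth at a point, a bump-function localisation of a form smooth near a point;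
* **`dolbeaultBar_typeComponent_zero_one_apply_eq_zero`** — if `α` is a `1`-form smooth near `x`
  and `(dα)^{0,2}` vanishes at `x` (e.g. `dα` is of type `(1,1)` near `x`), then
  `∂̄(α^{0,1}) = 0` at `x` (`d = ∂ + ∂̄`: `d` of a `(1,0)`-form has no `(0,2)`-part);
* **`apply_eq_of_real_of_typeComponent_eq_dolbeaultBar`** — a REAL `1`-form `α` whose
  `(0,1)`-part at `x` is `∂̄φ` for a complex function `φ` smooth at `x` equals
  `d(Re φ) − (d Im φ) ∘ J` at `x` (Cauchy–Riemann bookkeeping: both sides are real with the same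
  `(0,1)`-part);
* **`mextDeriv_apply_eq_neg_of_real_of_dolbeaultBar`** — hence, where this holds near `x`,
  `dα = −d((d Im φ) ∘ J)` at `x` (`dd = 0`), the shape consumed by the cocycle construction
  (`NikulinTwinTransportLefschetzOneOneK3Cocycle.lean`);
* **`mdifferentiableOn_sub_sub_of_dolbeaultBar`** — on an open `V`, if `α_i^{0,1} = ∂̄φ_i`,
  `α_j^{0,1} = ∂̄φ_j` and `df = α_i − α_j` pointwise, then `u = φ_i − φ_j − f` is holomorphic on
  `V` (`∂̄u = 0`, Voisin I Lemma 2.29).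
-/

noncomputable section

open scoped Manifold ContDiff Topology ComplexConjugate
open Set Filter
open Literature.Geometry.Kaehler
open Literature.NumberTheory.Transcendental

namespace Summit.HodgeConjecture.HodgeConjecture.Theorems

section Local

variable {E : Type} [NormedAddCommGroup E] [NormedSpace ℂ E]
  {M : Type} [TopologicalSpace M] [ChartedSpace E M]

/-! ### Pointwise bookkeeping: type components, conjugation, `∘ J` -/

/-- The type component at a point depends only on the value of the form at that point. [folklore] -/
theorem typeComponent_apply_congr {k : ℕ} (p q : ℕ) {β β' : MForm 𝓘(ℝ, E) M ℂ k} {x : M}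
    (h : β x = β' x) : β.typeComponent p q x = β'.typeComponent p q x := by
  rw [typeComponent_apply_eq_typeProjAt, typeComponent_apply_eq_typeProjAt, h]

/-- `(β ∘ J)‾ = β̄ ∘ J`. [folklore] -/
theorem conj_compJ (β : MForm 𝓘(ℝ, E) M ℂ 1) : β.compJ.conj = β.conj.compJ := by
  funext x; ext v; rfl

/-- Conjugation of forms is compatible with subtraction. [folklore] -/
theorem conj_sub {k : ℕ} (β γ : MForm 𝓘(ℝ, E) M ℂ k) : (β - γ).conj = β.conj - γ.conj := by
  funext x; ext v; simp

/-- The `0`-form of a real-valued function (cast to `ℂ`) is real. [folklore] -/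
theorem conj_ofFun_ofReal (g : M → ℝ) :
    (MForm.ofFun 𝓘(ℝ, E) fun y ↦ ((g y : ℝ) : ℂ)).conj = MForm.ofFun 𝓘(ℝ, E) fun y ↦ ((g y : ℝ) : ℂ) := by
  funext x; ext v; simp

/-- **A real `1`-form with vanishing `(0,1)`-part at `x` vanishes at `x`**: `γ = γ^{1,0} + γ^{0,1}`
and `γ^{1,0} = \overline{(γ̄)^{0,1}} = \overline{γ^{0,1}}` for real `γ`. [cite: VoisinHodgeI2002, §2.3.1] -/
theorem apply_eq_zero_of_conj_eq_of_typeComponent_zero_one_eq_zero {γ : MForm 𝓘(ℝ, E) M ℂ 1}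
    (hγ : γ.conj = γ) {x : M} (h01 : γ.typeComponent 0 1 x = 0) : γ x = 0 := by
  have h10 : γ.typeComponent 1 0 x = 0 := by
    have h := congrFun (typeComponent_conj_holds (E := E) (M := M) (k := 1) 1 0 γ) x
    rw [hγ] at h
    rw [h]
    change (Complex.conjCLE : ℂ →L[ℝ] ℂ).compContinuousAlternatingMap (γ.typeComponent 0 1 x) = 0
    rw [h01]
    ext v; simp
  rw [apply_eq_typeComponent_add γ x, h10, h01, add_zero]

/-! ### Smoothness at a point: conjugates, localisation, type components -/

/-- The conjugate of a form smooth at `x` is smooth at `x`. [folklore] -/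
theorem smoothAt_conj {k : ℕ} {α : MForm 𝓘(ℝ, E) M ℂ k} {x : M} (hα : α.SmoothAt x) :
    α.conj.SmoothAt x := by
  rw [MForm.SmoothAt, MForm.inChart_conj]
  exact ((ContinuousLinearMap.compContinuousAlternatingMapCLM ℝ E ℂ ℂ (Fin k)
    (Complex.conjCLE : ℂ →L[ℝ] ℂ)).contDiff.of_le le_top).comp_contDiffWithinAt hα

variable [FiniteDimensional ℂ E] [T2Space M] [IsManifold 𝓘(ℝ, E) ∞ M]

/-- **Localisation**: a form smooth near `x` agrees near `x` with a globally smooth form (cut off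
by a smooth bump function equal to `1` near `x`). [folklore] -/
theorem exists_isSmoothForm_eventuallyEq_nhds {k : ℕ} {α : MForm 𝓘(ℝ, E) M ℂ k} {x : M}
    (hα : ∀ᶠ z in 𝓝 x, α.SmoothAt z) :
    ∃ β : MForm 𝓘(ℝ, E) M ℂ k, IsSmoothForm β ∧ ∀ᶠ z in 𝓝 x, β z = α z := by
  obtain ⟨W, hWs, hWo, hxW⟩ := eventually_nhds_iff.1 hα
  obtain ⟨f, -, hf⟩ := (SmoothBumpFunction.nhds_basis_tsupport (I := 𝓘(ℝ, E)) x).mem_iff.1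
    (hWo.mem_nhds hxW)
  refine ⟨(f : M → ℝ) • α, ?_, ?_⟩
  · refine (isSmoothForm_iff_smoothAt _).2 fun z ↦ ?_
    by_cases hz : z ∈ W
    · exact (hWs z hz).fun_smul f.contMDiff.contMDiffAt
    · have h0 : (f : M → ℝ) =ᶠ[𝓝 z] 0 := notMem_tsupport_iff_eventuallyEq.1 fun h ↦ hz (hf h)
      refine MForm.smoothAt_of_eventuallyEq_zero ?_
      filter_upwards [h0] with w hw
      rw [Pi.smul_apply', hw, Pi.zero_apply, zero_smul]
  · filter_upwards [f.eventuallyEq_one] with z hz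
    rw [Pi.smul_apply', hz, Pi.one_apply, one_smul]

variable [IsManifold 𝓘(ℂ, E) ω M]

/-- **Type components of a form smooth near `x` are smooth at `x`** (localise and use the global
`isSmoothForm_typeComponent`). [cite: VoisinHodgeI2002, §2.3.1] -/
theorem smoothAt_typeComponent {k : ℕ} (p q : ℕ) {α : MForm 𝓘(ℝ, E) M ℂ k} {x : M}
    (hα : ∀ᶠ z in 𝓝 x, α.SmoothAt z) : (α.typeComponent p q).SmoothAt x := by
  obtain ⟨β, hβs, hβα⟩ := exists_isSmoothForm_eventuallyEq_nhds hα
  have hsm : IsSmoothForm (β.typeComponent p q) := isSmoothForm_typeComponent_holds p q hβs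
  exact MForm.SmoothAt.congr_of_eventuallyEq ((isSmoothForm_iff_smoothAt _).1 hsm x)
    (typeComponent_eventuallyEq p q hβα)

/-- **`∂̄(α^{0,1}) = 0` at `x` when `(dα)^{0,2} = 0` at `x`**, for a `1`-form `α` smooth near `x`:
localise `α` to a global smooth `β`; `dβ = dβ^{1,0} + dβ^{0,1}` and `(dβ^{1,0})^{0,2} = 0`
(`d` maps `A^{1,0}` into `A^{2,0} ⊕ A^{1,1}` on a complex manifold), so
`∂̄(β^{0,1}) = (dβ^{0,1})^{0,2} = (dβ)^{0,2}`, which at `x` is `(dα)^{0,2} = 0`.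
[cite: VoisinHodgeI2002, §2.3.1 Def. 2.27 and §2.3.3] -/
theorem dolbeaultBar_typeComponent_zero_one_apply_eq_zero {α : MForm 𝓘(ℝ, E) M ℂ 1} {x : M}
    (hα : ∀ᶠ z in 𝓝 x, α.SmoothAt z) (h02 : (mextDeriv α).typeComponent 0 2 x = 0) :
    dolbeaultBar (α.typeComponent 0 1) x = 0 := by
  obtain ⟨β, hβs, hβα⟩ := exists_isSmoothForm_eventuallyEq_nhds hα
  have hev : ∀ᶠ z in 𝓝 x, (α.typeComponent 0 1) z = (β.typeComponent 0 1) z :=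
    (typeComponent_eventuallyEq 0 1 hβα).mono fun z hz ↦ hz.symm
  rw [dolbeaultBar_congr_of_eventuallyEq hev]
  have hdβ : mextDeriv β x = mextDeriv α x := mextDeriv_congr_of_eventuallyEq hβα
  have h02β : (mextDeriv β).typeComponent 0 2 x = 0 := by
    rw [typeComponent_apply_congr 0 2 hdβ, h02]
  have h01t : IsOfType 0 1 (β.typeComponent 0 1) := isOfType_typeComponent_holds (p := 0) (q := 1) rfl β
  have h10t : IsOfType 1 0 (β.typeComponent 1 0) := isOfType_typeComponent_holds (p := 1) (q := 0) rfl β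
  have h01s : IsSmoothForm (β.typeComponent 0 1) := isSmoothForm_typeComponent_holds 0 1 hβs
  have h10s : IsSmoothForm (β.typeComponent 1 0) := isSmoothForm_typeComponent_holds 1 0 hβs
  rw [IsOfType.dolbeaultBar_eq_holds h01t]
  -- `dβ = dβ^{1,0} + dβ^{0,1}` and `(dβ^{1,0})^{0,2} = 0`
  have hsplit : β = β.typeComponent 1 0 + β.typeComponent 0 1 :=
    funext fun y ↦ apply_eq_typeComponent_add β y
  have hd : mextDeriv β = mextDeriv (β.typeComponent 1 0) + mextDeriv (β.typeComponent 0 1) := by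
    conv_lhs => rw [hsplit]
    exact mextDeriv_add h10s h01s
  have hvan : (mextDeriv (β.typeComponent 1 0)).typeComponent 0 2 = 0 :=
    h10t.typeComponent_mextDeriv_eq_zero (r := 0) (s := 2) h10s (by simp) (by simp)
  have key : (mextDeriv (β.typeComponent 0 1)).typeComponent 0 2 =
      (mextDeriv β).typeComponent 0 2 := by
    rw [hd, MForm.typeComponent_add, hvan, zero_add]
  exact (congrFun key x).trans h02β

/-! ### Cauchy–Riemann bookkeeping for a complex function `φ` -/

omit [FiniteDimensional ℂ E] [T2Space M] [IsManifold 𝓘(ℂ, E) ω M] in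
/-- **`(d Re φ − (d Im φ) ∘ J)^{0,1} = (dφ)^{0,1}` at a point where `φ` is real-`C^∞`**: the
difference `d Re φ − (d Im φ) ∘ J − dφ = −((d Im φ) ∘ J + i d Im φ)` is `ℂ`-linear at every point,
hence has no `(0,1)`-part (`typeComponent_zero_one_apply_eq_zero_iff`). [cite: VoisinHodgeI2002, §2.3.1] -/
theorem typeComponent_zero_one_re_sub_compJ_im {φ : M → ℂ} {x : M}
    (hφ : (MForm.ofFun 𝓘(ℝ, E) φ).SmoothAt x) :
    (mextDeriv (MForm.ofFun 𝓘(ℝ, E) fun y ↦ (((φ y).re : ℝ) : ℂ)) -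
        (mextDeriv (MForm.ofFun 𝓘(ℝ, E) fun y ↦ (((φ y).im : ℝ) : ℂ))).compJ).typeComponent 0 1 x =
      (mextDeriv (MForm.ofFun 𝓘(ℝ, E) φ)).typeComponent 0 1 x := by
  rw [← sub_eq_zero, ← Pi.sub_apply, ← MForm.typeComponent_sub,
    typeComponent_zero_one_apply_eq_zero_iff]
  -- the chart derivative `D` of `φ` at `x` and those of `Re φ`, `Im φ`
  set e := extChartAt 𝓘(ℝ, E) x with he
  have hsm : ContDiffAt ℝ ∞ (φ ∘ e.symm) (e x) := by
    have h := (MForm.smoothAt_ofFun_iff (I := 𝓘(ℝ, E)) φ x).1 hφ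
    rwa [ModelWithCorners.Boundaryless.range_eq_univ, contDiffWithinAt_univ] at h
  have hD : HasFDerivAt (φ ∘ e.symm) (fderiv ℝ (φ ∘ e.symm) (e x)) (e x) :=
    (hsm.differentiableAt (by simp)).hasFDerivAt
  set D : E →L[ℝ] ℂ := fderiv ℝ (φ ∘ e.symm) (e x) with hD_def
  have hre : fderiv ℝ ((fun y ↦ (((φ y).re : ℝ) : ℂ)) ∘ e.symm) (e x) =
      Complex.ofRealCLM.comp (Complex.reCLM.comp D) :=
    (Complex.ofRealCLM.hasFDerivAt.comp _ (Complex.reCLM.hasFDerivAt.comp _ hD)).fderiv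
  have him : fderiv ℝ ((fun y ↦ (((φ y).im : ℝ) : ℂ)) ∘ e.symm) (e x) =
      Complex.ofRealCLM.comp (Complex.imCLM.comp D) :=
    (Complex.ofRealCLM.hasFDerivAt.comp _ (Complex.imCLM.hasFDerivAt.comp _ hD)).fderiv
  -- the difference evaluated on a tangent vector, through `p = D w`, `q = D (i w)`
  have e1 : ∀ u : Fin 1 → TangentSpace 𝓘(ℝ, E) x,
      (mextDeriv (MForm.ofFun 𝓘(ℝ, E) fun y ↦ (((φ y).re : ℝ) : ℂ)) -
          (mextDeriv (MForm.ofFun 𝓘(ℝ, E) fun y ↦ (((φ y).im : ℝ) : ℂ))).compJ -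
          mextDeriv (MForm.ofFun 𝓘(ℝ, E) φ)) x u =
        ((D (u 0)).re : ℂ) - ((D (Complex.I • (show E from u 0) : E)).im : ℂ) - D (u 0) := by
    intro u
    simp only [Pi.sub_apply, ContinuousAlternatingMap.sub_apply]
    rw [MForm.compJ_apply, mextDeriv_ofFun_apply', mextDeriv_ofFun_apply', mextDeriv_ofFun_apply',
      ← he, hre, him]
    rfl
  intro θ v
  have hR : ∀ u : E, (Complex.exp (θ * Complex.I) • u : E) =
      Real.cos θ • u + Real.sin θ • (Complex.I • u : E) := by
    intro u
    rw [Complex.exp_mul_I, ← Complex.ofReal_cos, ← Complex.ofReal_sin, add_smul, mul_smul,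
      Complex.coe_smul, Complex.coe_smul]
  rw [e1, e1]
  change ((D (Complex.exp (θ * Complex.I) • (show E from v 0))).re : ℂ) -
      ((D (Complex.I • (Complex.exp (θ * Complex.I) • (show E from v 0)))).im : ℂ) -
      D (Complex.exp (θ * Complex.I) • (show E from v 0)) =
    Complex.exp (θ * Complex.I) *
      (((D (show E from v 0)).re : ℂ) - ((D (Complex.I • (show E from v 0))).im : ℂ) -
        D (show E from v 0))
  generalize (show E from v 0) = w
  have h1 : D (Complex.exp (θ * Complex.I) • w) =
      (Real.cos θ : ℂ) * D w + (Real.sin θ : ℂ) * D (Complex.I • w) := by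
    rw [hR, map_add, D.map_smul, D.map_smul, Complex.real_smul, Complex.real_smul]
  have h2 : D (Complex.I • (Complex.exp (θ * Complex.I) • w)) =
      (Real.cos θ : ℂ) * D (Complex.I • w) - (Real.sin θ : ℂ) * D w := by
    rw [smul_comm, hR, map_add, D.map_smul, D.map_smul, smul_smul, Complex.I_mul_I, neg_one_smul,
      map_neg, Complex.real_smul, Complex.real_smul]
    ring
  rw [h1, h2]
  generalize D w = p
  generalize D (Complex.I • w) = q
  apply Complex.ext
  · simp only [Complex.sub_re, Complex.add_re, Complex.ofReal_re, Complex.mul_re, Complex.ofReal_im,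
      Complex.sub_im, Complex.mul_im, Complex.exp_ofReal_mul_I_re,
      Complex.exp_ofReal_mul_I_im, zero_mul, sub_zero]
    ring
  · simp only [Complex.sub_im, Complex.add_im, Complex.ofReal_im, Complex.mul_im, Complex.ofReal_re,
      Complex.sub_re, Complex.add_re, Complex.mul_re, Complex.exp_ofReal_mul_I_re,
      Complex.exp_ofReal_mul_I_im, zero_mul, sub_zero]
    ring

/-! ### From `α^{0,1} = ∂̄φ` for a real `1`-form `α` to `dα = −d((d Im φ) ∘ J)` -/

omit [FiniteDimensional ℂ E] [T2Space M] [IsManifold 𝓘(ℝ, E) ∞ M] [IsManifold 𝓘(ℂ, E) ω M] in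
/-- `d` of a real function (cast to `ℂ`) is a real form. [folklore] -/
theorem conj_mextDeriv_ofFun_ofReal (g : M → ℝ) :
    (mextDeriv (MForm.ofFun 𝓘(ℝ, E) fun y ↦ ((g y : ℝ) : ℂ))).conj =
      mextDeriv (MForm.ofFun 𝓘(ℝ, E) fun y ↦ ((g y : ℝ) : ℂ)) := by
  rw [← mextDeriv_conj_holds, conj_ofFun_ofReal]

omit [FiniteDimensional ℂ E] [T2Space M] [IsManifold 𝓘(ℝ, E) ∞ M] [IsManifold 𝓘(ℂ, E) ω M] in
/-- The `0`-forms `Re φ`, `Im φ` (cast to `ℂ`) are smooth where `φ` is. [folklore] -/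
theorem smoothAt_ofFun_reIm {φ : M → ℂ} {x : M} (hφ : (MForm.ofFun 𝓘(ℝ, E) φ).SmoothAt x) :
    (MForm.ofFun 𝓘(ℝ, E) fun y ↦ (((φ y).re : ℝ) : ℂ)).SmoothAt x ∧
      (MForm.ofFun 𝓘(ℝ, E) fun y ↦ (((φ y).im : ℝ) : ℂ)).SmoothAt x := by
  rw [MForm.smoothAt_ofFun_iff] at hφ ⊢
  rw [MForm.smoothAt_ofFun_iff]
  exact ⟨(Complex.ofRealCLM.contDiff.comp Complex.reCLM.contDiff).comp_contDiffWithinAt hφ,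
    (Complex.ofRealCLM.contDiff.comp Complex.imCLM.contDiff).comp_contDiffWithinAt hφ⟩

omit [FiniteDimensional ℂ E] [T2Space M] [IsManifold 𝓘(ℝ, E) ∞ M] [IsManifold 𝓘(ℂ, E) ω M] in
/-- `d` is compatible with subtraction at a point where both forms are smooth. [folklore] -/
theorem mextDeriv_sub_apply {k : ℕ} {α β : MForm 𝓘(ℝ, E) M ℂ k} {x : M} (hα : α.SmoothAt x)
    (hβ : β.SmoothAt x) : mextDeriv (α - β) x = mextDeriv α x - mextDeriv β x := by
  have hneg : mextDeriv (-β) = -mextDeriv β := by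
    have h := mextDeriv_smul (-1 : ℝ) β
    simp only [neg_one_smul] at h
    exact h
  rw [sub_eq_add_neg, mextDeriv_add_apply hα hβ.neg, hneg, Pi.neg_apply, sub_eq_add_neg]

omit [FiniteDimensional ℂ E] [T2Space M] [IsManifold 𝓘(ℂ, E) ω M] in
/-- **A real `1`-form whose `(0,1)`-part at `x` is `∂̄φ` equals `d Re φ − (d Im φ) ∘ J` at `x`**
(`φ` real-`C^∞` at `x`): the difference is a real `1`-form with vanishing `(0,1)`-part at `x`
(`typeComponent_zero_one_re_sub_compJ_im`). This is the pointwise content of "`α = 2 Re ∂̄φ`",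
i.e. `α = ∂̄φ + ∂φ̄`. [cite: VoisinHodgeI2002, §2.3.1] -/
theorem apply_eq_of_conj_eq_of_typeComponent_eq_dolbeaultBar {α : MForm 𝓘(ℝ, E) M ℂ 1}
    (hα : α.conj = α) {φ : M → ℂ} {x : M} (hφ : (MForm.ofFun 𝓘(ℝ, E) φ).SmoothAt x)
    (h01 : α.typeComponent 0 1 x = dolbeaultBar (MForm.ofFun 𝓘(ℝ, E) φ) x) :
    α x = (mextDeriv (MForm.ofFun 𝓘(ℝ, E) fun y ↦ (((φ y).re : ℝ) : ℂ)) -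
      (mextDeriv (MForm.ofFun 𝓘(ℝ, E) fun y ↦ (((φ y).im : ℝ) : ℂ))).compJ) x := by
  set ρ : MForm 𝓘(ℝ, E) M ℂ 1 := mextDeriv (MForm.ofFun 𝓘(ℝ, E) fun y ↦ (((φ y).re : ℝ) : ℂ)) -
    (mextDeriv (MForm.ofFun 𝓘(ℝ, E) fun y ↦ (((φ y).im : ℝ) : ℂ))).compJ with hρ
  rw [← sub_eq_zero, ← Pi.sub_apply]
  refine apply_eq_zero_of_conj_eq_of_typeComponent_zero_one_eq_zero ?_ ?_
  · rw [conj_sub, hα, hρ, conj_sub, conj_compJ, conj_mextDeriv_ofFun_ofReal,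
      conj_mextDeriv_ofFun_ofReal]
  · rw [MForm.typeComponent_sub, Pi.sub_apply, h01, hρ, typeComponent_zero_one_re_sub_compJ_im hφ,
      dolbeaultBar_zeroForm, sub_self]

omit [FiniteDimensional ℂ E] [T2Space M] in
/-- **`dα = −d((d Im φ) ∘ J)` at `x`** for a real `1`-form `α` with `α^{0,1} = ∂̄φ` near `x`
(`φ` real-`C^∞` near `x`): near `x` one has `α = d Re φ − (d Im φ) ∘ J`, `d` is local and
additive on forms smooth at `x`, and `dd Re φ = 0`. (`−d((d Im φ) ∘ J) = 2i ∂∂̄ Im φ`.)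
[cite: VoisinHodgeI2002, §2.3.1 and §3.3.1] -/
theorem mextDeriv_apply_eq_neg_of_conj_eq_of_typeComponent_eq_dolbeaultBar
    {α : MForm 𝓘(ℝ, E) M ℂ 1} (hα : α.conj = α) {φ : M → ℂ} {x : M}
    (hφ : ∀ᶠ z in 𝓝 x, (MForm.ofFun 𝓘(ℝ, E) φ).SmoothAt z)
    (h01 : ∀ᶠ z in 𝓝 x, α.typeComponent 0 1 z = dolbeaultBar (MForm.ofFun 𝓘(ℝ, E) φ) z) :
    mextDeriv α x =
      -(mextDeriv (mextDeriv (MForm.ofFun 𝓘(ℝ, E) fun y ↦ (((φ y).im : ℝ) : ℂ))).compJ x) := by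
  have hev : ∀ᶠ z in 𝓝 x, α z = (mextDeriv (MForm.ofFun 𝓘(ℝ, E) fun y ↦ (((φ y).re : ℝ) : ℂ)) -
      (mextDeriv (MForm.ofFun 𝓘(ℝ, E) fun y ↦ (((φ y).im : ℝ) : ℂ))).compJ) z := by
    filter_upwards [hφ, h01] with z hz hz'
    exact apply_eq_of_conj_eq_of_typeComponent_eq_dolbeaultBar hα hz hz'
  have hre : ∀ᶠ z in 𝓝 x, (MForm.ofFun 𝓘(ℝ, E) fun y ↦ (((φ y).re : ℝ) : ℂ)).SmoothAt z :=
    hφ.mono fun z hz ↦ (smoothAt_ofFun_reIm hz).1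
  have him : ∀ᶠ z in 𝓝 x, (MForm.ofFun 𝓘(ℝ, E) fun y ↦ (((φ y).im : ℝ) : ℂ)).SmoothAt z :=
    hφ.mono fun z hz ↦ (smoothAt_ofFun_reIm hz).2
  have hdre : (mextDeriv (MForm.ofFun 𝓘(ℝ, E) fun y ↦ (((φ y).re : ℝ) : ℂ))).SmoothAt x :=
    MForm.SmoothAt.mextDeriv hre
  have hdimJ : (mextDeriv (MForm.ofFun 𝓘(ℝ, E) fun y ↦ (((φ y).im : ℝ) : ℂ))).compJ.SmoothAt x := by
    have h : ∀ᶠ z in 𝓝 x, (mextDeriv (MForm.ofFun 𝓘(ℝ, E) fun y ↦ (((φ y).im : ℝ) : ℂ))).SmoothAt z := by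
      filter_upwards [him.eventually_nhds] with z hz
      exact MForm.SmoothAt.mextDeriv hz
    exact (MForm.eventually_smoothAt_compJ h).self_of_nhds
  rw [mextDeriv_congr_of_eventuallyEq hev, mextDeriv_sub_apply hdre hdimJ,
    mextDeriv_mextDeriv_of_smoothAt hre, zero_sub]

/-! ### Holomorphy of `u = φ_i − φ_j − f` -/

omit [FiniteDimensional ℂ E] [T2Space M] [IsManifold 𝓘(ℝ, E) ∞ M] [IsManifold 𝓘(ℂ, E) ω M] in
/-- The `0`-form of `φ₁ − φ₂ − f`. [folklore] -/
theorem ofFun_sub_sub (φ₁ φ₂ : M → ℂ) (f : M → ℝ) :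
    (MForm.ofFun 𝓘(ℝ, E) fun y ↦ φ₁ y - φ₂ y - f y) =
      MForm.ofFun 𝓘(ℝ, E) φ₁ - MForm.ofFun 𝓘(ℝ, E) φ₂ - MForm.ofFun 𝓘(ℝ, E) fun y ↦ ((f y : ℝ) : ℂ) := by
  funext x; ext v; rfl

omit [FiniteDimensional ℂ E] [T2Space M] [IsManifold 𝓘(ℂ, E) ω M] in
/-- **`u = φ_i − φ_j − f` is holomorphic on `V`** when, at the points of the open set `V`,
`α_i^{0,1} = ∂̄φ_i`, `α_j^{0,1} = ∂̄φ_j` and `df = α_i − α_j` (all data real-`C^∞` there):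
`∂̄u = α_i^{0,1} − α_j^{0,1} − (α_i − α_j)^{0,1} = 0`, and `∂̄`-closed functions are holomorphic
(`mdifferentiableOn_of_dolbeaultBar_ofFun_eq_zero`). [cite: VoisinHodgeI2002, §2.3.3 Lemma 2.29] -/
theorem mdifferentiableOn_sub_sub_of_dolbeaultBar {V : Set M} {φ₁ φ₂ : M → ℂ} {f : M → ℝ}
    {α₁ α₂ : MForm 𝓘(ℝ, E) M ℂ 1}
    (hφ₁ : ∀ z ∈ V, (MForm.ofFun 𝓘(ℝ, E) φ₁).SmoothAt z)
    (hφ₂ : ∀ z ∈ V, (MForm.ofFun 𝓘(ℝ, E) φ₂).SmoothAt z)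
    (hf : ∀ z ∈ V, (MForm.ofFun 𝓘(ℝ, E) fun y ↦ ((f y : ℝ) : ℂ)).SmoothAt z)
    (h₁ : ∀ z ∈ V, α₁.typeComponent 0 1 z = dolbeaultBar (MForm.ofFun 𝓘(ℝ, E) φ₁) z)
    (h₂ : ∀ z ∈ V, α₂.typeComponent 0 1 z = dolbeaultBar (MForm.ofFun 𝓘(ℝ, E) φ₂) z)
    (hdf : ∀ z ∈ V, mextDeriv (MForm.ofFun 𝓘(ℝ, E) fun y ↦ ((f y : ℝ) : ℂ)) z = α₁ z - α₂ z) :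
    MDifferentiableOn 𝓘(ℂ, E) 𝓘(ℂ, ℂ) (fun y ↦ φ₁ y - φ₂ y - f y) V := by
  refine mdifferentiableOn_of_dolbeaultBar_ofFun_eq_zero (fun z hz ↦ ?_) (fun z hz ↦ ?_)
  · rw [ofFun_sub_sub]
    exact ((hφ₁ z hz).sub (hφ₂ z hz)).sub (hf z hz)
  · rw [dolbeaultBar_zeroForm, ofFun_sub_sub]
    have hd : mextDeriv (MForm.ofFun 𝓘(ℝ, E) φ₁ - MForm.ofFun 𝓘(ℝ, E) φ₂ -
        MForm.ofFun 𝓘(ℝ, E) fun y ↦ ((f y : ℝ) : ℂ)) z =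
        (mextDeriv (MForm.ofFun 𝓘(ℝ, E) φ₁) - mextDeriv (MForm.ofFun 𝓘(ℝ, E) φ₂) - (α₁ - α₂)) z := by
      rw [mextDeriv_sub_apply ((hφ₁ z hz).sub (hφ₂ z hz)) (hf z hz),
        mextDeriv_sub_apply (hφ₁ z hz) (hφ₂ z hz), hdf z hz]
      rfl
    rw [typeComponent_apply_congr 0 1 hd, MForm.typeComponent_sub, MForm.typeComponent_sub,
      MForm.typeComponent_sub, Pi.sub_apply, Pi.sub_apply, Pi.sub_apply, h₁ z hz, h₂ z hz,
      dolbeaultBar_zeroForm, dolbeaultBar_zeroForm, sub_self]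

end Local

end Summit.HodgeConjecture.HodgeConjecture.Theorems

end
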